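import Mathlib
import Literature.Geometry.DiscreteGeometry.CrystallographicGroups
import Summits.AtomisticToContinuum.Crystallization.Theses.IsometryAtoms
import Summits.AtomisticToContinuum.Crystallization.Theorems.IsometryAtomsMinimisingLawsCohesiveGroupStructureAux1
import Summits.AtomisticToContinuum.Crystallization.Theorems.IsometryAtomsMinimisingLawsCohesiveGroupStructureAux2
import Summits.AtomisticToContinuum.Crystallization.Theorems.IsometryAtomsMinimisingLawsCohesiveGroupStructureAux3
import Summits.AtomisticToContinuum.Crystallization.Theorems.IsometryAtomsMinimisingLawsCohesiveGroupStructureAux4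
import Summits.AtomisticToContinuum.Crystallization.Theorems.IsometryAtomsMinimisingLawsCohesiveGroupStructureAux5
import Summits.AtomisticToContinuum.Crystallization.Theorems.IsometryAtomsMinimisingLawsCohesiveGroupStructureAux6
import Summits.AtomisticToContinuum.Crystallization.Theorems.IsometryAtomsMinimisingLawsCohesiveGroupStructureCentroid
import Summits.AtomisticToContinuum.Crystallization.Theorems.IsometryAtomsMinimisingLawsCohesiveGroupStructureLineOrbit
import Summits.AtomisticToContinuum.Crystallization.Theorems.IsometryAtomsMinimisingLawsCohesiveGroupStructureLineBound

/-!
# Stub `stub_groupStructure` (F) of line `purity_stacking` — crux `IsometryAtoms.MinimisingLawsCohesive`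
# (stmt-AtomisticToContinuum-15777): structure of discontinuous groups of isometries of `ℝ³`

**Theorem (elementary Bieberbach in dimension three).** For every subgroup `Γ` of the isometry
group of `ℝ³` acting discontinuously (`Crystallographic.IsDiscontinuous`):
(i) the finite subgroups of `Γ` have bounded order, and
(ii) either `Γ` contains three linearly independent translations, or `Γ` leaves invariant a
nonempty affine subspace of dimension `≤ 2` (a point, a line or a plane).

**Proof** (assembly of parts 1–6 and the three sub-goals Centroid / LineOrbit / LineBound), by the
rank of the translation vectors `T` of `Γ`:
* three independent translation vectors: (ii-a) directly; finitely many linear parts (part 2), so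
  (i) by part 1;
* two, spanning a plane containing `T`: finitely many linear parts (part 2) ⇒ (i); and an invariant
  plane `{⟨x, n⟩ = h₀}` (part 2);
* one, `T ⊆ ℝ e`: every linear part maps `e` to `±e`; finitely many linear parts ⇒ (i) by part 1 and
  an invariant line by the centroid of the projected orbit (LineOrbit); infinitely many ⇒ an
  invariant axis line (part 6, the screw case) and (i) by the line bound (LineBound);
* none: `Γ` finite ⇒ a fixed point (Centroid) and `|H| ≤ |Γ|`; `Γ` infinite ⇒ the linear parts are
  infinite (injectivity), part 4 gives a small nontrivial rotation with axis `u`, Bieberbach's lemma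
  (part 5) shows every linear part maps `u` to `±u`, part 6 gives the invariant axis line and
  LineBound gives (i).
-/

noncomputable section

open scoped RealInnerProductSpace
open Literature.Geometry.DiscreteGeometry.Crystallographic Module

namespace Summit.AtomisticToContinuum.Crystallization.Theorems.IsometryAtomsMinimisingLawsCohesive

open GroupStructure

/-! ## Small packaging lemmas -/

namespace GroupStructure

/-- The line `c + ℝ e` as an invariant affine subspace of dimension `≤ 2`. -/
theorem exists_affine_of_line {Γ : Subgroup (EuclideanSpace ℝ (Fin 3) ≃ᵢ EuclideanSpace ℝ (Fin 3))}
    {c e : EuclideanSpace ℝ (Fin 3)} (he : ‖e‖ = 1)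
    (hc : ∀ g ∈ Γ, g '' (AffineSubspace.mk' c (Submodule.span ℝ {e}) : Set (EuclideanSpace ℝ (Fin 3))) =
      AffineSubspace.mk' c (Submodule.span ℝ {e})) :
    ∃ V : AffineSubspace ℝ (EuclideanSpace ℝ (Fin 3)),
      (V : Set (EuclideanSpace ℝ (Fin 3))).Nonempty ∧ Module.finrank ℝ V.direction ≤ 2 ∧
      ∀ g ∈ Γ, g '' (V : Set (EuclideanSpace ℝ (Fin 3))) = V := by
  have he0 : e ≠ 0 := by
    intro h; rw [h, norm_zero] at he; exact zero_ne_one he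
  refine ⟨AffineSubspace.mk' c (Submodule.span ℝ {e}), AffineSubspace.mk'_nonempty _ _, ?_, hc⟩
  rw [AffineSubspace.direction_mk', finrank_span_singleton he0]
  norm_num

/-- A fixed point as an invariant affine subspace of dimension `≤ 2`. -/
theorem exists_affine_of_point {Γ : Subgroup (EuclideanSpace ℝ (Fin 3) ≃ᵢ EuclideanSpace ℝ (Fin 3))}
    {p : EuclideanSpace ℝ (Fin 3)} (hp : ∀ g ∈ Γ, g p = p) :
    ∃ V : AffineSubspace ℝ (EuclideanSpace ℝ (Fin 3)),
      (V : Set (EuclideanSpace ℝ (Fin 3))).Nonempty ∧ Module.finrank ℝ V.direction ≤ 2 ∧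
      ∀ g ∈ Γ, g '' (V : Set (EuclideanSpace ℝ (Fin 3))) = V := by
  refine ⟨AffineSubspace.mk' p ⊥, AffineSubspace.mk'_nonempty _ _, ?_, fun g hg => ?_⟩
  · rw [AffineSubspace.direction_mk', finrank_bot]; norm_num
  · have hV : (AffineSubspace.mk' p (⊥ : Submodule ℝ (EuclideanSpace ℝ (Fin 3))) : Set (EuclideanSpace ℝ (Fin 3))) = {p} := by
      ext x
      rw [SetLike.mem_coe, AffineSubspace.mem_mk', Submodule.mem_bot, vsub_eq_sub, sub_eq_zero,
        Set.mem_singleton_iff]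
    rw [hV, Set.image_singleton, hp g hg]

/-- Rank one: all translation vectors are multiples of a nonzero `w ∈ T` once no two of them are
independent. -/
theorem exists_smul_of_no_pair {T : Set (EuclideanSpace ℝ (Fin 3))}
    (h2 : ¬ ∃ v : Fin 2 → EuclideanSpace ℝ (Fin 3), LinearIndependent ℝ v ∧ ∀ i, v i ∈ T)
    {w : EuclideanSpace ℝ (Fin 3)} (hwT : w ∈ T) (hw0 : w ≠ 0) {v : EuclideanSpace ℝ (Fin 3)} (hv : v ∈ T) :
    ∃ a : ℝ, v = a • w := by
  by_contra hcon
  push Not at hcon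
  apply h2
  refine ⟨![w, v], (LinearIndependent.pair_iff' hw0).2 fun a ha => hcon a ha.symm, fun i => ?_⟩
  fin_cases i
  · simpa using hwT
  · simpa using hv

/-- A linear isometry mapping a nonzero `w` to a multiple of itself maps it to `±w`, hence the unit
vector `e = w/‖w‖` to `±e`. -/
theorem lin_unit_eq_or {L : EuclideanSpace ℝ (Fin 3) ≃ₗᵢ[ℝ] EuclideanSpace ℝ (Fin 3)} {w : EuclideanSpace ℝ (Fin 3)} (hw0 : w ≠ 0)
    {a : ℝ} (ha : L w = a • w) :
    L (‖w‖⁻¹ • w) = ‖w‖⁻¹ • w ∨ L (‖w‖⁻¹ • w) = -(‖w‖⁻¹ • w) := by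
  have hwn : ‖w‖ ≠ 0 := norm_ne_zero_iff.2 hw0
  have habs : |a| = 1 := by
    have h := congrArg (fun x => ‖x‖) ha
    simp only [LinearIsometryEquiv.norm_map, norm_smul, Real.norm_eq_abs] at h
    field_simp at h
    linarith [h]
  rcases abs_eq (zero_le_one) |>.1 habs with h | h
  · left; rw [map_smul, ha, h, one_smul]
  · right; rw [map_smul, ha, h, neg_one_smul, smul_neg]

end GroupStructure

/-! ## The stub -/

/-- **Stub `stub_groupStructure`** of line `purity_stacking` (crux `IsometryAtoms.MinimisingLawsCohesive`,
stmt-AtomisticToContinuum-15777): structure of discontinuous groups of isometries of `ℝ³` —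
finite subgroups have bounded order, and either three independent translations or an invariant
nonempty affine subspace of dimension `≤ 2`. -/
theorem stub_groupStructure :
    ∀ Γ : Subgroup (EuclideanSpace ℝ (Fin 3) ≃ᵢ EuclideanSpace ℝ (Fin 3)),
      Literature.Geometry.DiscreteGeometry.Crystallographic.IsDiscontinuous Γ →
      (∃ N : ℕ, ∀ H : Subgroup (EuclideanSpace ℝ (Fin 3) ≃ᵢ EuclideanSpace ℝ (Fin 3)),
          H ≤ Γ → Finite H → Nat.card H ≤ N) ∧
      ((∃ v : Fin 3 → EuclideanSpace ℝ (Fin 3),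
          LinearIndependent ℝ v ∧ ∀ i, IsometryEquiv.addRight (v i) ∈ Γ) ∨
       (∃ V : AffineSubspace ℝ (EuclideanSpace ℝ (Fin 3)),
          (V : Set (EuclideanSpace ℝ (Fin 3))).Nonempty ∧ Module.finrank ℝ V.direction ≤ 2 ∧
          ∀ g ∈ Γ, g '' (V : Set (EuclideanSpace ℝ (Fin 3))) = V)) := by
  intro Γ hΓ
  -- RANK THREE
  by_cases h3 : ∃ v : Fin 3 → EuclideanSpace ℝ (Fin 3), LinearIndependent ℝ v ∧ ∀ i, v i ∈ translationVectors Γ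
  · obtain ⟨v, hv, hvT⟩ := h3
    exact ⟨exists_bound_of_finite_linParts Γ (finite_linParts_of_three hΓ hv hvT),
      Or.inl ⟨v, hv, fun i => (mem_translationVectors_iff Γ (v i)).1 (hvT i)⟩⟩
  -- RANK TWO
  by_cases h2 : ∃ v : Fin 2 → EuclideanSpace ℝ (Fin 3), LinearIndependent ℝ v ∧ ∀ i, v i ∈ translationVectors Γ
  · obtain ⟨v, hv, hvT⟩ := h2
    have hT : translationVectors Γ ⊆ Submodule.span ℝ (Set.range v) := by
      intro w hw
      by_contra hw'
      apply h3
      refine ⟨Fin.cons w v, linearIndependent_finCons.2 ⟨hv, hw'⟩, fun i => ?_⟩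
      refine Fin.cases ?_ (fun j => ?_) i
      · simpa using hw
      · simpa using hvT j
    -- a unit normal of the translation plane
    set W : Submodule ℝ (EuclideanSpace ℝ (Fin 3)) := Submodule.span ℝ (Set.range v) with hW
    have hWrank : finrank ℝ W = 2 := by rw [hW, finrank_span_eq_card hv]; simp
    have hWorth : finrank ℝ Wᗮ = 1 := by
      have := Submodule.finrank_add_finrank_orthogonal W
      rw [hWrank, finrank_euclideanSpace, Fintype.card_fin] at this
      omega
    have hne : Wᗮ ≠ ⊥ := by
      intro h; rw [h, finrank_bot] at hWorth; exact zero_ne_one hWorth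
    obtain ⟨m, hmW, hm0⟩ := Submodule.exists_mem_ne_zero_of_ne_bot hne
    have hmn : ‖m‖ ≠ 0 := norm_ne_zero_iff.2 hm0
    set n : EuclideanSpace ℝ (Fin 3) := ‖m‖⁻¹ • m with hn
    have hnW : n ∈ Wᗮ := Submodule.smul_mem _ _ hmW
    have hn1 : ‖n‖ = 1 := by rw [hn, norm_smul, norm_inv, norm_norm, inv_mul_cancel₀ hmn]
    have hfin := finite_linParts_of_two hΓ hv hvT hT hnW hn1
    exact ⟨exists_bound_of_finite_linParts Γ hfin,
      Or.inr (exists_invariant_plane hvT hT hnW hn1 (fun g hg => lin_normal_eq_or hv hvT hT hnW hn1 hg) hfin)⟩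
  -- RANK ONE
  by_cases h1 : ∃ w ∈ translationVectors Γ, w ≠ 0
  · obtain ⟨w, hwT, hw0⟩ := h1
    have hwn : ‖w‖ ≠ 0 := norm_ne_zero_iff.2 hw0
    set e : EuclideanSpace ℝ (Fin 3) := ‖w‖⁻¹ • w with he
    have he1 : ‖e‖ = 1 := by rw [he, norm_smul, norm_inv, norm_norm, inv_mul_cancel₀ hwn]
    have hwe : w = ‖w‖ • e := by rw [he, smul_smul, mul_inv_cancel₀ hwn, one_smul]
    have hTe : ∀ v ∈ translationVectors Γ, ∃ s : ℝ, v = s • e := by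
      intro v hv
      obtain ⟨a, rfl⟩ := exists_smul_of_no_pair h2 hwT hw0 hv
      exact ⟨a * ‖w‖, by rw [mul_smul, ← hwe]⟩
    have hax : ∀ g ∈ Γ, g.toRealLinearIsometryEquiv e = e ∨ g.toRealLinearIsometryEquiv e = -e := by
      intro g hg
      obtain ⟨a, ha⟩ := exists_smul_of_no_pair h2 hwT hw0 (lin_apply_mem_translationVectors Γ hg hwT)
      exact lin_unit_eq_or hw0 ha
    by_cases hfin : ((fun g : EuclideanSpace ℝ (Fin 3) ≃ᵢ EuclideanSpace ℝ (Fin 3) => g.toRealLinearIsometryEquiv) ''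
        (Γ : Set (EuclideanSpace ℝ (Fin 3) ≃ᵢ EuclideanSpace ℝ (Fin 3)))).Finite
    · obtain ⟨c, hc⟩ := groupStructure_invariantLine_of_finite_linParts Γ e he1 hax hTe hfin
      exact ⟨exists_bound_of_finite_linParts Γ hfin, Or.inr (exists_affine_of_line he1 hc)⟩
    · obtain ⟨c, hc⟩ := groupStructure_invariantLine_of_infinite_linParts Γ hΓ e he1 hax hTe hfin
      exact ⟨groupStructure_card_le_of_invariantLine Γ hΓ c e he1 hc, Or.inr (exists_affine_of_line he1 hc)⟩
  -- RANK ZERO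
  have hT0 : ∀ v ∈ translationVectors Γ, v = 0 := by
    intro v hv
    by_contra h
    exact h1 ⟨v, hv, h⟩
  by_cases hΓfin : Finite Γ
  · obtain ⟨p, hp⟩ := groupStructure_fixedPoint_of_finite Γ hΓfin
    refine ⟨⟨Nat.card Γ, fun H hH _ => Subgroup.card_le_of_le hH⟩, Or.inr (exists_affine_of_point hp)⟩
  · -- infinitely many elements, hence (injectivity of the linear part) infinitely many linear parts
    have hinj : Set.InjOn (fun g : EuclideanSpace ℝ (Fin 3) ≃ᵢ EuclideanSpace ℝ (Fin 3) => g.toRealLinearIsometryEquiv)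
        (Γ : Set (EuclideanSpace ℝ (Fin 3) ≃ᵢ EuclideanSpace ℝ (Fin 3))) := by
      intro g hg h hh hgh
      obtain ⟨heq, hmem⟩ := sub_mem_translationVectors_of_lin_eq Γ hg hh hgh
      have h0 := hT0 _ hmem
      rw [h0, addRight_zero] at heq
      exact (inv_mul_eq_one.1 heq)
    have hinf : ((fun g : EuclideanSpace ℝ (Fin 3) ≃ᵢ EuclideanSpace ℝ (Fin 3) => g.toRealLinearIsometryEquiv) ''
        (Γ : Set (EuclideanSpace ℝ (Fin 3) ≃ᵢ EuclideanSpace ℝ (Fin 3)))).Infinite := by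
      rw [Set.infinite_image_iff hinj]
      exact Set.infinite_coe_iff.1 (not_finite_iff_infinite.1 hΓfin)
    obtain ⟨g, hg, hA1, hdet, hsmall⟩ := exists_small_rotation hinf (by norm_num : (0 : ℝ) < 1 / 10) (by norm_num)
    obtain ⟨u, hu1, hu⟩ := exists_fixed_unit_of_det_eq_one _ hdet
    have hax : ∀ h ∈ Γ, h.toRealLinearIsometryEquiv u = u ∨ h.toRealLinearIsometryEquiv u = -u :=
      fun h hh => lin_axis_of_no_translations hΓ hT0 hg hA1 hdet hsmall.le hu1 hu hh
    have hTu : ∀ v ∈ translationVectors Γ, ∃ s : ℝ, v = s • u :=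
      fun v hv => ⟨0, by rw [hT0 v hv, zero_smul]⟩
    obtain ⟨c, hc⟩ := groupStructure_invariantLine_of_infinite_linParts Γ hΓ u hu1 hax hTu hinf
    exact ⟨groupStructure_card_le_of_invariantLine Γ hΓ c u hu1 hc, Or.inr (exists_affine_of_line hu1 hc)⟩

end Summit.AtomisticToContinuum.Crystallization.Theorems.IsometryAtomsMinimisingLawsCohesive

end
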